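import Literature.AlgebraicGeometry.Motives.AbstractHodgeTate
import HarnessLib

/-!
# The Hodge conjecture relative to Betti–Hodge data: the codimension window (proofs)

Sibling proofs file of `Motives/AbstractHodgeTate` (no new definitions). For Betti–Hodge
realization data `B : Literature.BettiHodgeData k` over a subfield `k ⊆ ℂ` and a smooth projective `X`
of dimension `n`, the per-variety Hodge conjecture `B.HodgeConjectureFor hX p`
(`ℚ · Aᵖ(X) = Hdgᵖ(X)`, `Motives/BettiRealization`) is settled at both ends of the codimension
range by the axioms alone:

* `p = 0`: `Hdg⁰(X) ⊆ H⁰(X) = ℚ · [X]` — the tree's `Literature.AlgebraicGeometry.Motives.hodgeConjectureFor_zero_holds`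
  (Voisin, *Hodge Theory I*, §11.3);
* `p > n`: `H²ᵖ(X) = 0` (Weil-cohomology axiom (A), `WeilCohomology.subsingleton_obj`; Kleiman,
  *Algebraic cycles and the Weil conjectures* (1968), §1.2 (A)), so both sides are the zero
  submodule — `BettiHodgeData.hodgeConjectureFor_of_dim_lt` below.

Hence any failure of `B.HodgeConjectureFor hX p` has `0 < p ≤ n`
(`BettiHodgeData.pos_and_le_of_not_hodgeConjectureFor`). These two lemmas are used by the barrier
catalogue (`Barriers/HodgeConjecture/MotivatedClassesAbelianVarieties`, the codimension window of
a hypothetical counterexample on an abelian variety).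

## References

* [Kleiman1968] S. Kleiman, Algebraic cycles and the Weil conjectures (1968), §1.2 (A).
* [VoisinHodgeI2002] C. Voisin, Hodge Theory and Complex Algebraic Geometry I, §11.3.
-/

noncomputable section

open CategoryTheory AlgebraicGeometry

namespace Literature.AlgebraicGeometry.Motives

namespace BettiHodgeData

variable {k : Type} [Field k] [Algebra k ℂ]

/-- Above the dimension there is nothing to prove: `H²ᵖ(X) = 0` for `p > dim X`
(Weil-cohomology axiom (A), `WeilCohomology.subsingleton_obj`; Kleiman 1968, §1.2 (A)), so
`ℚ · Aᵖ(X) = Hdgᵖ(X)` holds in every codimension `p > n` for every realization datum `B`.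
[cite: Kleiman1968, §1.2 (A)] -/
theorem hodgeConjectureFor_of_dim_lt (B : BettiHodgeData k) {n : ℕ} {X : SchemeOver k}
    (hX : IsSmoothProjective n X) {p : ℕ} (hp : n < p) : B.HodgeConjectureFor hX p := by
  haveI : Subsingleton (B.W.obj X (2 * p)) := B.W.subsingleton_obj hX (by omega)
  exact ((Submodule.subsingleton_iff ℚ).2 ‹_›).elim _ _

/-- The codimension window of the Hodge conjecture: if `B.HodgeConjectureFor hX p` fails for a
smooth projective `X` of dimension `n`, then `0 < p ≤ n` — the case `p = 0` is
`Hodge.hodgeConjectureFor_zero_holds` (`Hdg⁰ = ℚ · [X]`, Voisin I, §11.3) and the range `p > n`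
is `hodgeConjectureFor_of_dim_lt`. [folklore] -/
theorem pos_and_le_of_not_hodgeConjectureFor (B : BettiHodgeData k) {n : ℕ} {X : SchemeOver k}
    (hX : IsSmoothProjective n X) {p : ℕ} (h : ¬ B.HodgeConjectureFor hX p) : 0 < p ∧ p ≤ n := by
  refine ⟨Nat.pos_of_ne_zero ?_, le_of_not_gt fun hp ↦ h (B.hodgeConjectureFor_of_dim_lt hX hp)⟩
  rintro rfl
  exact h (Motives.hodgeConjectureFor_zero_holds B hX)

end BettiHodgeData

end Literature.AlgebraicGeometry.Motives

end
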